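import Mathlib.Analysis.Calculus.FDeriv.Analytic
import Summits.AtomisticToContinuum.HydrodynamicLimit.Theorems.VitaliAmplitudeTransferAmplitudeTransferTools

/-!
# Amplitude transfer — construction of the path of profiles (step (2))

Elementary lemmas for the path of local Gibbs profiles `a_δ = e^{-μ} Rinv (ρ^δ(0, ·))`,
`θ_δ = θ^δ(0, ·)`, `u_δ = u^δ(0, ·)` built from the pre-shock family of `AnalyticPreShockPaths` and
the local equation of state `R`, `Rinv` and chemical potential `μ` of `LocalGibbsStatics` (route
`VitaliAmplitudeTransfer`, item `AmplitudeTransfer`):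

* bounds: `e^{μ} ∈ [(2B₀)⁻¹, 2B₀]` from `∫ R(e^μ a₀) = 1`, the data bounds `4B₀²` of the
  identified solution, and the path bounds `32B₀³`;
* regularity: analyticity / `C¹` of space–time lifts under composition with the analytic `Rinv`,
  slicing the jointly `C¹` family at a fixed time, and reparametrising sub-paths `δ ↦ δ₂δ`;
* uniqueness of the chemical potential along the path (strict monotonicity of the mass
  `μ ↦ ∫ R(e^μ a)`), which makes the path LLN-matched to the family.
-/

noncomputable section

open MeasureTheory Filter Set Topology
open scoped ENNReal

namespace Summit.AtomisticToContinuum.HydrodynamicLimit.Theorems.AmplitudeTransfer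

open Literature.MathematicalPhysics.KineticTheory Literature.Analysis.FluidPDE
open Literature.Analysis.FunctionSpaces

/-! ### Bounds -/

/-- **Bounds on the fugacity `e^μ`** from the unit mass `∫ R(e^μ a₀) = 1`, the two-sided
comparison `z/2 ≤ R z ≤ 2z` and the profile bounds `B₀⁻¹ ≤ a₀ ≤ B₀`. -/
theorem exp_mu_bounds {B₀ Bz : ℝ} (hB₀ : 1 ≤ B₀) {R : ℝ → ℝ} {a₀ : T3 → ℝ} {μ : ℝ}
    (hR : ∀ z ∈ Icc (0 : ℝ) Bz, z / 2 ≤ R z ∧ R z ≤ 2 * z) (hRc : ContinuousOn R (Icc 0 Bz))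
    (ha : Continuous a₀) (hbd : ∀ x, B₀⁻¹ ≤ a₀ x ∧ a₀ x ≤ B₀)
    (hrange : ∀ x, Real.exp μ * a₀ x ∈ Icc (0 : ℝ) Bz) (hmass : ∫ x, R (Real.exp μ * a₀ x) = 1) :
    (2 * B₀)⁻¹ ≤ Real.exp μ ∧ Real.exp μ ≤ 2 * B₀ := by
  have hB0 : 0 < B₀ := by linarith
  have he : 0 < Real.exp μ := Real.exp_pos μ
  have hcont : Continuous fun x => R (Real.exp μ * a₀ x) :=
    hRc.comp_continuous (continuous_const.mul ha) hrange
  have hint : Integrable fun x => R (Real.exp μ * a₀ x) := integrable_of_continuous_T3 hcont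
  constructor
  · -- `1 = ∫ R ≤ ∫ 2 e^μ a₀ ≤ 2 e^μ B₀`
    have h1 : ∫ x, R (Real.exp μ * a₀ x) ≤ ∫ _x : T3, 2 * (Real.exp μ * B₀) := by
      refine integral_mono hint (integrable_const _) fun x => ?_
      calc R (Real.exp μ * a₀ x) ≤ 2 * (Real.exp μ * a₀ x) := (hR _ (hrange x)).2
        _ ≤ 2 * (Real.exp μ * B₀) := by gcongr; exact (hbd x).2
    rw [hmass, integral_const_T3] at h1
    rw [inv_le_iff_one_le_mul₀ (by positivity)]
    linarith
  · -- `1 = ∫ R ≥ ∫ e^μ a₀ / 2 ≥ e^μ / (2B₀)`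
    have h1 : ∫ _x : T3, Real.exp μ * B₀⁻¹ / 2 ≤ ∫ x, R (Real.exp μ * a₀ x) := by
      refine integral_mono (integrable_const _) hint fun x => ?_
      calc Real.exp μ * B₀⁻¹ / 2 ≤ Real.exp μ * a₀ x / 2 := by gcongr; exact (hbd x).1
        _ ≤ R (Real.exp μ * a₀ x) := (hR _ (hrange x)).1
    rw [hmass, integral_const_T3] at h1
    rw [div_le_iff₀ (by norm_num : (0 : ℝ) < 2)] at h1
    calc Real.exp μ = Real.exp μ * B₀⁻¹ * B₀ := by field_simp
      _ ≤ 1 * 2 * B₀ := by gcongr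
      _ = 2 * B₀ := by ring

/-- **Data bounds of the identified solution**: `R(c y) ∈ [(4B₀²)⁻¹, 4B₀²]` for
`c ∈ [(2B₀)⁻¹, 2B₀]`, `y ∈ [B₀⁻¹, B₀]`. -/
theorem R_value_bounds {B₀ Bz : ℝ} (hB₀ : 1 ≤ B₀) {R : ℝ → ℝ}
    (hR : ∀ z ∈ Icc (0 : ℝ) Bz, z / 2 ≤ R z ∧ R z ≤ 2 * z) {c y : ℝ}
    (hc : (2 * B₀)⁻¹ ≤ c ∧ c ≤ 2 * B₀) (hy : B₀⁻¹ ≤ y ∧ y ≤ B₀) (hmem : c * y ∈ Icc (0 : ℝ) Bz) :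
    (4 * B₀ ^ 2)⁻¹ ≤ R (c * y) ∧ R (c * y) ≤ 4 * B₀ ^ 2 := by
  have hB0 : 0 < B₀ := by linarith
  have hc0 : 0 < c := lt_of_lt_of_le (by positivity) hc.1
  have hy0 : 0 < y := lt_of_lt_of_le (by positivity) hy.1
  obtain ⟨h1, h2⟩ := hR _ hmem
  have hlow : (2 * B₀)⁻¹ * B₀⁻¹ ≤ c * y := mul_le_mul hc.1 hy.1 (by positivity) hc0.le
  have hup : c * y ≤ 2 * B₀ * B₀ := mul_le_mul hc.2 hy.2 hy0.le (by positivity)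
  have heq : (4 * B₀ ^ 2)⁻¹ = (2 * B₀)⁻¹ * B₀⁻¹ / 2 := by field_simp; ring
  constructor
  · rw [heq]; linarith
  · nlinarith

/-- **Path bounds**: `c · Rinv y ∈ [(32B₀³)⁻¹, 32B₀³]` for `c ∈ [(2B₀)⁻¹, 2B₀]` and family data
`y ∈ [(8B₀²)⁻¹, 8B₀²]`, with `y/2 ≤ Rinv y ≤ 2y`. -/
theorem path_value_bounds {B₀ : ℝ} (hB₀ : 1 ≤ B₀) {Rinv : ℝ → ℝ}
    (hRinv : ∀ y ∈ Icc (0 : ℝ) (2 * (32 * B₀ ^ 3)), y / 2 ≤ Rinv y ∧ Rinv y ≤ 2 * y) {c y : ℝ}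
    (hc : (2 * B₀)⁻¹ ≤ c ∧ c ≤ 2 * B₀)
    (hy : (2 * (4 * B₀ ^ 2))⁻¹ ≤ y ∧ y ≤ 2 * (4 * B₀ ^ 2)) :
    (32 * B₀ ^ 3)⁻¹ ≤ c * Rinv y ∧ c * Rinv y ≤ 32 * B₀ ^ 3 := by
  have hB0 : 0 < B₀ := by linarith
  have hB1 : 1 ≤ B₀ ^ 3 := one_le_pow₀ hB₀
  have hc0 : 0 < c := lt_of_lt_of_le (by positivity) hc.1
  have hy0 : 0 < y := lt_of_lt_of_le (by positivity) hy.1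
  have hymem : y ∈ Icc (0 : ℝ) (2 * (32 * B₀ ^ 3)) := ⟨hy0.le, hy.2.trans (by nlinarith)⟩
  obtain ⟨h1, h2⟩ := hRinv y hymem
  have hR0 : 0 ≤ Rinv y := le_trans (by positivity) h1
  have hlow : (2 * B₀)⁻¹ * ((2 * (4 * B₀ ^ 2))⁻¹ / 2) ≤ c * Rinv y :=
    mul_le_mul hc.1 (le_trans (by linarith [hy.1]) h1) (by positivity) hc0.le
  have hup : c * Rinv y ≤ 2 * B₀ * (2 * (2 * (4 * B₀ ^ 2))) :=
    mul_le_mul hc.2 (h2.trans (by linarith [hy.2])) hR0 (by positivity)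
  have heq : (32 * B₀ ^ 3)⁻¹ = (2 * B₀)⁻¹ * ((2 * (4 * B₀ ^ 2))⁻¹ / 2) := by field_simp; ring
  constructor
  · rw [heq]; exact hlow
  · linarith

/-! ### Regularity of composed, sliced and reparametrised lifts -/

/-- **Analyticity of a composed lift**: `(δ, x) ↦ c · g (f δ x)` has analytic lift on `D × ℝ³` if
`f` has and `g` is analytic on a set containing the values of `f`. -/
theorem analyticOnNhd_stLift_comp {g : ℝ → ℝ} {S : Set ℝ} (hg : AnalyticOnNhd ℝ g S)
    {f : ℝ → T3 → ℝ} {D : Set ℝ} (hf : AnalyticOnNhd ℝ (Torus.stLift f) (D ×ˢ univ))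
    (hmaps : ∀ δ ∈ D, ∀ x, f δ x ∈ S) (c : ℝ) :
    AnalyticOnNhd ℝ (Torus.stLift fun δ x => c * g (f δ x)) (D ×ˢ univ) := by
  intro p hp
  have hp1 : p.1 ∈ D := (mem_prod.1 hp).1
  have hval : Torus.stLift f p ∈ S := hmaps p.1 hp1 (Torus.proj p.2)
  have h1 : AnalyticAt ℝ (g ∘ Torus.stLift f) p := (hg _ hval).comp (hf p hp)
  have h3 : Torus.stLift (fun δ x => c * g (f δ x)) = fun q => c * (g ∘ Torus.stLift f) q := rfl
  rw [h3]
  exact analyticAt_const.mul h1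

/-- **`C¹` of a composed lift**, as `analyticOnNhd_stLift_comp`. -/
theorem contDiffOn_stLift_comp {g : ℝ → ℝ} {S : Set ℝ} (hg : ContDiffOn ℝ 1 g S)
    {f : ℝ → T3 → ℝ} {D : Set ℝ} (hf : ContDiffOn ℝ 1 (Torus.stLift f) (D ×ˢ univ))
    (hmaps : ∀ δ ∈ D, ∀ x, f δ x ∈ S) (c : ℝ) :
    ContDiffOn ℝ 1 (Torus.stLift fun δ x => c * g (f δ x)) (D ×ˢ univ) := by
  have h1 : ContDiffOn ℝ 1 (g ∘ Torus.stLift f) (D ×ˢ univ) :=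
    hg.comp hf fun p hp => hmaps p.1 (mem_prod.1 hp).1 _
  exact contDiffOn_const.mul h1

/-- **Slicing the jointly `C¹` family at a fixed time** `s₀ ∈ [0, t]` gives a `C¹` space–time
lift in `(δ, x)` on `[0,1] × ℝ³`. -/
theorem contDiffOn_stLift_slice {F' : Type*} [NormedAddCommGroup F'] [NormedSpace ℝ F']
    {G : ℝ → ℝ → T3 → F'} {t s₀ : ℝ} (hs₀ : s₀ ∈ Icc (0 : ℝ) t)
    (h : ContDiffOn ℝ 1 (fun p : ℝ × ℝ × EuclideanSpace ℝ (Fin 3) => G p.1 p.2.1 (Torus.proj p.2.2))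
      (Icc 0 1 ×ˢ Icc 0 t ×ˢ univ)) :
    ContDiffOn ℝ 1 (Torus.stLift fun δ => G δ s₀) (Icc 0 1 ×ˢ univ) := by
  have hι : ContDiff ℝ 1 fun p : ℝ × EuclideanSpace ℝ (Fin 3) => (p.1, s₀, p.2) :=
    contDiff_fst.prodMk (contDiff_const.prodMk contDiff_snd)
  have h2 := h.comp (hι.contDiffOn (s := Icc (0 : ℝ) 1 ×ˢ univ)) fun p hp =>
    mk_mem_prod (mem_prod.1 hp).1 (mk_mem_prod hs₀ (mem_univ _))
  exact h2

/-- **Reparametrised sub-paths** `δ ↦ δ₂δ`, `δ₂ ∈ [0,1)`, of a family with analytic lift on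
`[0,1) × ℝ³` have analytic lift on `[0,1] × ℝ³`. -/
theorem analyticOnNhd_stLift_subpath {F' : Type*} [NormedAddCommGroup F'] [NormedSpace ℝ F']
    {f : ℝ → T3 → F'} (hf : AnalyticOnNhd ℝ (Torus.stLift f) (Ico 0 1 ×ˢ univ)) {δ₂ : ℝ}
    (hδ₂ : δ₂ ∈ Ico (0 : ℝ) 1) :
    AnalyticOnNhd ℝ (Torus.stLift fun δ => f (δ₂ * δ)) (Icc 0 1 ×ˢ univ) := by
  intro p hp
  have hp1 : p.1 ∈ Icc (0 : ℝ) 1 := (mem_prod.1 hp).1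
  have hmem : (δ₂ * p.1, p.2) ∈ Ico (0 : ℝ) 1 ×ˢ (univ : Set (EuclideanSpace ℝ (Fin 3))) :=
    mk_mem_prod ⟨mul_nonneg hδ₂.1 hp1.1, by nlinarith [hδ₂.2, hp1.2, hδ₂.1]⟩ (mem_univ _)
  have hL : AnalyticAt ℝ (fun q : ℝ × EuclideanSpace ℝ (Fin 3) => (δ₂ * q.1, q.2)) p :=
    (analyticAt_const.mul analyticAt_fst).prod analyticAt_snd
  exact AnalyticAt.comp (f := fun q : ℝ × EuclideanSpace ℝ (Fin 3) => (δ₂ * q.1, q.2)) (x := p)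
    (hf _ hmem) hL

/-- `C¹` version of `analyticOnNhd_stLift_subpath` for lifts `C¹` on `[0,1] × ℝ³` and
`δ₂ ∈ [0,1]`. -/
theorem contDiffOn_stLift_subpath {F' : Type*} [NormedAddCommGroup F'] [NormedSpace ℝ F']
    {f : ℝ → T3 → F'} (hf : ContDiffOn ℝ 1 (Torus.stLift f) (Icc 0 1 ×ˢ univ)) {δ₂ : ℝ}
    (hδ₂ : δ₂ ∈ Icc (0 : ℝ) 1) :
    ContDiffOn ℝ 1 (Torus.stLift fun δ => f (δ₂ * δ)) (Icc 0 1 ×ˢ univ) := by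
  have hL : ContDiff ℝ 1 fun q : ℝ × EuclideanSpace ℝ (Fin 3) => (δ₂ * q.1, q.2) :=
    (contDiff_const.mul contDiff_fst).prodMk contDiff_snd
  exact hf.comp (hL.contDiffOn (s := Icc (0 : ℝ) 1 ×ˢ univ)) fun p hp =>
    mk_mem_prod ⟨mul_nonneg hδ₂.1 (mem_prod.1 hp).1.1,
      by nlinarith [hδ₂.2, (mem_prod.1 hp).1.2, hδ₂.1, (mem_prod.1 hp).1.1]⟩ (mem_univ _)

/-- Analytic lifts are `C¹` lifts. -/
theorem contDiffOn_of_analyticOnNhd_stLift {F' : Type*} [NormedAddCommGroup F'] [NormedSpace ℝ F']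
    [CompleteSpace F'] {f : ℝ → T3 → F'} {D : Set (ℝ × EuclideanSpace ℝ (Fin 3))}
    (hf : AnalyticOnNhd ℝ (Torus.stLift f) D) : ContDiffOn ℝ 1 (Torus.stLift f) D :=
  hf.contDiffOn_of_completeSpace

/-! ### Uniqueness of the chemical potential along the path -/

/-- **The mass `c ↦ ∫ R(c f)` is injective**: if `∫ R(c₁ f) = ∫ R(c₂ f)` for a continuous
positive `f` and `R` continuous strictly increasing on a range containing both `cᵢ f`, then
`R(c₁ f) = R(c₂ f)` pointwise (indeed `c₁ = c₂`). -/
theorem R_comp_eq_of_integral_eq {R : ℝ → ℝ} {Bz : ℝ} (hRmono : StrictMonoOn R (Icc 0 Bz))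
    (hRc : ContinuousOn R (Icc 0 Bz)) {f : T3 → ℝ} (hf : Continuous f) (hf0 : ∀ x, 0 < f x)
    {c₁ c₂ : ℝ} (h₁ : ∀ x, c₁ * f x ∈ Icc (0 : ℝ) Bz) (h₂ : ∀ x, c₂ * f x ∈ Icc (0 : ℝ) Bz)
    (hint : ∫ x, R (c₁ * f x) = ∫ x, R (c₂ * f x)) : ∀ x, R (c₁ * f x) = R (c₂ * f x) := by
  -- the strict case, in a form symmetric in `c₁, c₂`
  have key : ∀ {d₁ d₂ : ℝ}, (∀ x, d₁ * f x ∈ Icc (0 : ℝ) Bz) → (∀ x, d₂ * f x ∈ Icc (0 : ℝ) Bz) →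
      d₁ < d₂ → ∫ x, R (d₁ * f x) < ∫ x, R (d₂ * f x) := by
    intro d₁ d₂ hd₁ hd₂ hlt
    have hc1 : Continuous fun x => R (d₁ * f x) := hRc.comp_continuous (continuous_const.mul hf) hd₁
    have hc2 : Continuous fun x => R (d₂ * f x) := hRc.comp_continuous (continuous_const.mul hf) hd₂
    have hpt : ∀ x, R (d₁ * f x) < R (d₂ * f x) := fun x =>
      hRmono (hd₁ x) (hd₂ x) (mul_lt_mul_of_pos_right hlt (hf0 x))
    have hi1 := integrable_of_continuous_T3 hc1
    have hi2 := integrable_of_continuous_T3 hc2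
    have hpos : 0 < ∫ x, (R (d₂ * f x) - R (d₁ * f x)) := by
      rw [integral_pos_iff_support_of_nonneg (fun x => sub_nonneg.2 (hpt x).le) (hi2.sub hi1)]
      have : Function.support (fun x => R (d₂ * f x) - R (d₁ * f x)) = univ :=
        eq_univ_of_forall fun x => (sub_pos.2 (hpt x)).ne'
      rw [this]
      simp
    rw [integral_sub hi2 hi1] at hpos
    linarith
  rcases lt_trichotomy c₁ c₂ with hlt | heq | hgt
  · exact absurd hint (key h₁ h₂ hlt).ne
  · intro x; rw [heq]
  · exact absurd hint.symm (key h₂ h₁ hgt).ne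

end Summit.AtomisticToContinuum.HydrodynamicLimit.Theorems.AmplitudeTransfer

end
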